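import Summits.BirchSwinnertonDyer.BirchSwinnertonDyer.Theorems.ShaCotorsionReducible.Negative.RankTwoMemberData
import Literature.NumberTheory.EllipticCurves.LeadingTerm
import Literature.NumberTheory.EllipticCurves.X1ElevenMordellWeil

/-!
# Crux `ShaCotorsionReducible` (stmt-BirchSwinnertonDyer-15277): a sector member of Mordell–Weil rank `≥ 2`
# — the open residue `r_an ≥ 2` of the crux is inhabited (granting Gross–Zagier–Kolyvagin)

Second half (the argument) of the kernel certificate whose data half is `Negative/RankTwoMemberData.lean`
(curve `E = [-21,-22,-22,0,0]`, `N = 5302`, in the Eisenstein sector at `p = 5`; points `P = (-2,-8)`,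
`Q = (6,4)`; kernel-checked identities `5P`, `5Q`, `P - Q = (-20,-48)`, `10(P - Q)`; point counts
`#Ẽ(𝔽₃) = 5`, `#Ẽ(𝔽₅) = 10`, `#Ẽ(𝔽₁₃) = 20`). Record: `Cruxes/ShaCotorsionReducible/Disproof.lean` §5.

## Method (Silverman, *AEC* VII.2.1, VII.3.1 — reduction theory only)

* No `2`-power torsion in `E(ℚ)`: a non-zero point killed by `2ᵏ` would inject into `Ẽ(𝔽₃)` of odd order `5`
  (`eq_zero_of_two_pow_nsmul_eq_zero_5302`).
* Non-divisibility by `2` (`not_exists_two_nsmul_of_cert_5302`): if `X = 2Z` in `E(ℚ)` and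
  `N = #Ẽ(𝔽_q) = 2M` at a good odd prime `q`, then `M·X = N·Z` reduces to `Õ` (Lagrange in `Ẽ(𝔽_q)` through
  the tree's reduction homomorphism `reductionHom`), i.e. its `x`-coordinate is not `q`-integral; so a
  `q`-integral `x(M·X)` certifies `X ∉ 2E(ℚ)` — `P, Q` at `q = 5`, `P - Q` at `q = 13` (the class of `P - Q`
  is `2`-divisible in `Ẽ(𝔽₅)` and `Ẽ(𝔽₇)`).
* Independence (`indep_5302`): if `aP + bQ = O`, descend on `|a| + |b|` through the even–even case (no
  `2`-torsion) to `a` or `b` odd, where `P`, `Q` or `P - Q` would lie in `2E(ℚ)`.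

Consequences: `rank E(ℚ) ≥ 2` (`two_le_mordellWeilRank_5302`, with Mordell–Weil), `corank Sel_{5^∞} ≥ 2`
(Greenberg's identity), the strengthening "sector ⇒ rank ≤ 1" of the crux is FALSE
(`shaCotorsionReducible_strengthening_rank_le_one_false`), and, granting the GZK fact
`rank_eq_analyticRank_of_analyticRank_le_one` (`r_an ≤ 1 ⇒ rank = r_an`), the sector member `(E, 5)` has
`r_an ≥ 2` and `corank Sel ≥ 2`: the open residue of `Theorems.shaCotorsionReducible_iff_residue` (p150969)
is inhabited (`shaCotorsionReducible_residue_inhabited_of_GZK`). Theorems only; nothing asserts a Theses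
statement.

## References
* J. H. Silverman, *The Arithmetic of Elliptic Curves*, 2nd ed. (2009): VII.2 Prop. 2.1, VII.3 Prop. 3.1,
  Thm. VIII.6.7. [SilvermanAEC2009]
* R. Greenberg, LNM 1716 (1999), §1 pp. 54–57. [Greenberg1999LNM]
* H. Darmon, *Rational points on modular elliptic curves*, CBMS 101 (2004), Thm. 3.22. [Darmon2004]
-/

set_option linter.dupNamespace false

noncomputable section

open scoped Classical

namespace Summit.BirchSwinnertonDyer.BirchSwinnertonDyer.Theorems.ShaCotorsionReducible.Negative

open Literature.NumberTheory.EllipticCurves WeierstrassCurve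

/-! ## §3 Reduction lemmas for `E` at a good odd prime `q` -/

/-- **No non-zero point of `E(ℚ)` is killed by a power of `2`** (Silverman, *AEC* VII.3.1(b) at `q = 3`):
such a point would inject into `Ẽ(𝔽₃)`, of odd order `5`. [cite: SilvermanAEC2009, VII.3 Prop. 3.1(b)] -/
theorem eq_zero_of_two_pow_nsmul_eq_zero_5302
    (R : (⟨-21, -22, -22, 0, 0⟩ : WeierstrassCurve ℚ).toAffine.Point) (k : ℕ) (hR : (2 ^ k : ℕ) • R = 0) : R = 0 := by
  by_contra hR0
  haveI : Fact (Nat.Prime 3) := ⟨Nat.prime_three⟩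
  have hv := integers_valuationRing_valuation ℤ_[3] ℚ_[3]
  set W₀ : WeierstrassCurve ℤ_[3] := (⟨-21, -22, -22, 0, 0⟩ : WeierstrassCurve ℤ).map (Int.castRingHom ℤ_[3]) with hW₀
  have hW : (⟨-21, -22, -22, 0, 0⟩ : WeierstrassCurve ℚ).baseChange ℚ_[3] = W₀.baseChange ℚ_[3] := by
    rw [hW₀]; ext <;> simp [WeierstrassCurve.baseChange, WeierstrassCurve.map] <;> rfl
  set ι : (⟨-21, -22, -22, 0, 0⟩ : WeierstrassCurve ℚ).toAffine.Point →+ (W₀.baseChange ℚ_[3]).toAffine.Point :=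
    (Affine.Point.congrEquiv hW).toAddMonoidHom.comp
      (Affine.Point.map (W' := (⟨-21, -22, -22, 0, 0⟩ : WeierstrassCurve ℚ).toAffine) (S := ℚ) (Algebra.ofId ℚ ℚ_[3])) with hι
  have hιinj : Function.Injective ι :=
    (Affine.Point.congrEquiv hW).injective.comp
      (Affine.Point.map_injective (W' := (⟨-21, -22, -22, 0, 0⟩ : WeierstrassCurve ℚ).toAffine) (f := Algebra.ofId ℚ ℚ_[3]))
  set P' := ι R with hP'
  have hP0 : P' ≠ 0 := fun h ↦ hR0 (hιinj (by rw [map_zero]; exact h))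
  have hkP : ((2 ^ k : ℕ) : ℤ) • P' = 0 := by rw [natCast_zsmul, hP', ← map_nsmul, hR, map_zero]
  have hΔ : IsUnit W₀.Δ := by
    have hΔ' : W₀.Δ = ((1242025312 : ℤ) : ℤ_[3]) := by
      rw [hW₀, WeierstrassCurve.map_Δ, int5302_Δ, eq_intCast]
    rw [hΔ', PadicInt.isUnit_iff]
    refine le_antisymm (PadicInt.norm_le_one _) (not_lt.mp fun hlt ↦ ?_)
    have h := (PadicInt.norm_int_lt_one_iff_dvd (p := 3) 1242025312).mp hlt
    omega
  haveI : Finite (IsLocalRing.ResidueField ℤ_[3]) :=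
    Finite.of_equiv (ZMod 3) (PadicInt.residueField (p := 3)).symm.toEquiv
  haveI : Fintype (IsLocalRing.ResidueField ℤ_[3]) := Fintype.ofFinite _
  haveI : Finite (W₀.map (IsLocalRing.residue ℤ_[3])).toAffine.Point := finite_point _
  have hn : ValuationRing.valuation ℤ_[3] ℚ_[3] (((2 ^ k : ℕ) : ℤ) : ℚ_[3]) = 1 :=
    X1Eleven.valuation_natCast_eq_one 3 fun h ↦ by
      have h2 : (3 : ℕ) ∣ 2 := (Nat.Prime.prime (by norm_num)).dvd_of_dvd_pow h
      omega
  have hle : AddSubgroup.zmultiples P' ≤ W₀.nonsingularReductionSubgroup hv :=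
    AddSubgroup.zmultiples_le_of_mem (hasNonsingularReduction_of_isUnit_Δ hv hΔ P')
  set f : AddSubgroup.zmultiples P' →+ (W₀.map (IsLocalRing.residue ℤ_[3])).toAffine.Point :=
    (W₀.reductionHom hv).comp (AddSubgroup.inclusion hle) with hf_def
  have hf : Function.Injective f := by
    rw [injective_iff_map_eq_zero]
    rintro ⟨Q', hQ'⟩ hfQ
    obtain ⟨m, rfl⟩ := AddSubgroup.mem_zmultiples_iff.mp hQ'
    have hred : W₀.reducePoint (m • P') = 0 := hfQ
    have h0 : W₀.ReducesToZero (m • P') :=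
      (_root_.WeierstrassCurve.reducePoint_eq_zero_iff hv (hle hQ')).mp hred
    have hk' : ((2 ^ k : ℕ) : ℤ) • (m • P') = 0 := by
      rw [← mul_zsmul, mul_comm, mul_zsmul, hkP, zsmul_zero]
    by_contra hne
    exact not_reducesToZero_of_zsmul_eq_zero hv hn hk' (fun h ↦ hne (Subtype.ext h)) h0
  have hdvd : Nat.card (AddSubgroup.zmultiples P') ∣
      Nat.card (W₀.map (IsLocalRing.residue ℤ_[3])).toAffine.Point :=
    AddSubgroup.card_dvd_of_injective f hf
  have hcard : Nat.card (W₀.map (IsLocalRing.residue ℤ_[3])).toAffine.Point = 5 := by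
    have e1 : Nat.card ((W₀.map (IsLocalRing.residue ℤ_[3])).map
        (PadicInt.residueField (p := 3) : IsLocalRing.ResidueField ℤ_[3] →+* ZMod 3)).toAffine.Point =
        Nat.card (W₀.map (IsLocalRing.residue ℤ_[3])).toAffine.Point :=
      natCard_point_map_ringEquiv _ _
    have key : (W₀.map (IsLocalRing.residue ℤ_[3])).map
        (PadicInt.residueField (p := 3) : IsLocalRing.ResidueField ℤ_[3] →+* ZMod 3) =
        (⟨-21, -22, -22, 0, 0⟩ : WeierstrassCurve ℤ).map (Int.castRingHom (ZMod 3)) := by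
      rw [hW₀, WeierstrassCurve.map_map, WeierstrassCurve.map_map]
      congr 1
      exact RingHom.ext_int _ _
    rw [← e1, key]
    exact card_int5302_mod_three
  have hordP : addOrderOf P' ∣ 2 ^ k := by
    apply addOrderOf_dvd_of_nsmul_eq_zero
    rw [← natCast_zsmul]; exact hkP
  rw [Nat.card_zmultiples, hcard] at hdvd
  obtain ⟨j, -, hPj⟩ := (Nat.dvd_prime_pow Nat.prime_two).1 hordP
  have hj : j ≠ 0 := by
    rintro rfl
    rw [pow_zero, AddMonoid.addOrderOf_eq_one_iff] at hPj
    exact hP0 hPj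
  have h2 : 2 ∣ 5 := (dvd_pow_self 2 hj).trans (hPj ▸ hdvd)
  omega

/-- **Non-divisibility by `2` certified by reduction** (Silverman, *AEC* VII.2.1/VII.3.1): let `q` be an odd
prime of good reduction of `E` (`q ∤ Δ`), `N = #Ẽ(𝔽_q) = 2M`, and suppose `M·X` is an affine point whose
`x`-coordinate is `q`-integral. Then `X ∉ 2E(ℚ)`: if `X = 2Z` then `M·X = N·Z` maps to `N·Z̃ = Õ` in
`Ẽ(𝔽_q)` (Lagrange), so `M·X` lies in the kernel of reduction `E₁(ℚ_q)`, whose affine points have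
non-integral `x`. [cite: SilvermanAEC2009, VII.2 Prop. 2.1 and VII.3 Prop. 3.1] -/
theorem not_exists_two_nsmul_of_cert_5302 (q : ℕ) [Fact q.Prime] (hqΔ : ¬ ((q : ℤ) ∣ 1242025312))
    {N M : ℕ} (hMN : N = 2 * M)
    (hN : Nat.card (((⟨-21, -22, -22, 0, 0⟩ : WeierstrassCurve ℤ).map (Int.castRingHom (ZMod q))).toAffine.Point) = N)
    {X : (⟨-21, -22, -22, 0, 0⟩ : WeierstrassCurve ℚ).toAffine.Point} {x y : ℚ} {hxy : (⟨-21, -22, -22, 0, 0⟩ : WeierstrassCurve ℚ).toAffine.Nonsingular x y}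
    (hY : (M : ℕ) • X = Affine.Point.some x y hxy) (hden : ¬ q ∣ x.den) :
    ¬ ∃ Z : (⟨-21, -22, -22, 0, 0⟩ : WeierstrassCurve ℚ).toAffine.Point, X = (2 : ℕ) • Z := by
  rintro ⟨Z, rfl⟩
  have hv := integers_valuationRing_valuation ℤ_[q] ℚ_[q]
  set W₀ : WeierstrassCurve ℤ_[q] := (⟨-21, -22, -22, 0, 0⟩ : WeierstrassCurve ℤ).map (Int.castRingHom ℤ_[q]) with hW₀
  have hW : (⟨-21, -22, -22, 0, 0⟩ : WeierstrassCurve ℚ).baseChange ℚ_[q] = W₀.baseChange ℚ_[q] := by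
    rw [hW₀]; ext <;> simp [WeierstrassCurve.baseChange, WeierstrassCurve.map] <;> rfl
  set ι : (⟨-21, -22, -22, 0, 0⟩ : WeierstrassCurve ℚ).toAffine.Point →+ (W₀.baseChange ℚ_[q]).toAffine.Point :=
    (Affine.Point.congrEquiv hW).toAddMonoidHom.comp
      (Affine.Point.map (W' := (⟨-21, -22, -22, 0, 0⟩ : WeierstrassCurve ℚ).toAffine) (S := ℚ) (Algebra.ofId ℚ ℚ_[q])) with hι
  -- the image of `M • X` is the affine point with the same coordinates
  have e : ι (Affine.Point.some x y hxy) =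
      Affine.Point.congrEquiv hW (Affine.Point.map
        (W' := (⟨-21, -22, -22, 0, 0⟩ : WeierstrassCurve ℚ).toAffine) (S := ℚ) (Algebra.ofId ℚ ℚ_[q])
        (Affine.Point.some x y hxy)) := rfl
  rw [Affine.Point.map_some, Affine.Point.congrEquiv_some] at e
  -- good reduction at `q`
  have hΔ : IsUnit W₀.Δ := by
    have hΔ' : W₀.Δ = ((1242025312 : ℤ) : ℤ_[q]) := by
      rw [hW₀, WeierstrassCurve.map_Δ, int5302_Δ, eq_intCast]
    rw [hΔ', PadicInt.isUnit_iff]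
    refine le_antisymm (PadicInt.norm_le_one _) (not_lt.mp fun hlt ↦ ?_)
    exact hqΔ ((PadicInt.norm_int_lt_one_iff_dvd (p := q) 1242025312).mp hlt)
  haveI : Finite (IsLocalRing.ResidueField ℤ_[q]) :=
    Finite.of_equiv (ZMod q) (PadicInt.residueField (p := q)).symm.toEquiv
  haveI : Fintype (IsLocalRing.ResidueField ℤ_[q]) := Fintype.ofFinite _
  haveI : Finite (W₀.map (IsLocalRing.residue ℤ_[q])).toAffine.Point := finite_point _
  have hcard : Nat.card (W₀.map (IsLocalRing.residue ℤ_[q])).toAffine.Point = N := by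
    have e1 : Nat.card ((W₀.map (IsLocalRing.residue ℤ_[q])).map
        (PadicInt.residueField (p := q) : IsLocalRing.ResidueField ℤ_[q] →+* ZMod q)).toAffine.Point =
        Nat.card (W₀.map (IsLocalRing.residue ℤ_[q])).toAffine.Point :=
      natCard_point_map_ringEquiv _ _
    have key : (W₀.map (IsLocalRing.residue ℤ_[q])).map
        (PadicInt.residueField (p := q) : IsLocalRing.ResidueField ℤ_[q] →+* ZMod q) =
        (⟨-21, -22, -22, 0, 0⟩ : WeierstrassCurve ℤ).map (Int.castRingHom (ZMod q)) := by
      rw [hW₀, WeierstrassCurve.map_map, WeierstrassCurve.map_map]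
      congr 1
      exact RingHom.ext_int _ _
    rw [← e1, key]
    exact hN
  -- `N • Z` reduces to `Õ`: the reduction homomorphism on `E₀ = E(ℚ_q)` and Lagrange in `Ẽ(𝔽_q)`
  have hmem : ∀ R : (W₀.baseChange ℚ_[q]).toAffine.Point, R ∈ W₀.nonsingularReductionSubgroup hv :=
    fun R ↦ hasNonsingularReduction_of_isUnit_Δ hv hΔ R
  set z : W₀.nonsingularReductionSubgroup hv := ⟨ι Z, hmem _⟩ with hz
  have hNz : W₀.reductionHom hv (N • z) = 0 := by
    rw [map_nsmul, ← hcard]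
    exact card_nsmul_eq_zero'
  have hred : W₀.reducePoint (ι ((N : ℕ) • Z)) = 0 := by
    have : ((N • z : W₀.nonsingularReductionSubgroup hv) : (W₀.baseChange ℚ_[q]).toAffine.Point)
        = ι ((N : ℕ) • Z) := by
      rw [AddSubmonoidClass.coe_nsmul, hz, map_nsmul]
    rw [← this]
    exact hNz
  have h0 : W₀.ReducesToZero (ι ((N : ℕ) • Z)) :=
    (_root_.WeierstrassCurve.reducePoint_eq_zero_iff hv (hmem _)).mp hred
  -- but `N • Z = M • (2 • Z) = M • X` has `q`-integral `x`-coordinate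
  have hNM : (N : ℕ) • Z = (M : ℕ) • ((2 : ℕ) • Z) := by rw [hMN]; exact mul_nsmul Z 2 M
  rw [hNM, hY, e, _root_.WeierstrassCurve.reducesToZero_some_iff] at h0
  exact h0 ⟨⟨_, Padic.norm_rat_le_one hden⟩, rfl⟩

/-- **`P ∉ 2E(ℚ)`** (certificate: `q = 5`, `N = 10`, `5P` is `5`-integral). [cite: SilvermanAEC2009, VII.3 Prop. 3.1] -/
theorem not_exists_two_nsmul_P5302 :
    ¬ ∃ Z : (⟨-21, -22, -22, 0, 0⟩ : WeierstrassCurve ℚ).toAffine.Point, (Affine.Point.some _ _ nonsingular_5302_P : (⟨-21, -22, -22, 0, 0⟩ : WeierstrassCurve ℚ).toAffine.Point) = (2 : ℕ) • Z := by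
  haveI : Fact (Nat.Prime 5) := ⟨Nat.prime_five⟩
  exact not_exists_two_nsmul_of_cert_5302 5 (by decide) (N := 10) (M := 5) rfl card_int5302_mod_five
    five_nsmul_P5302 (by decide +kernel)

/-- **`Q ∉ 2E(ℚ)`** (certificate: `q = 5`, `N = 10`, `5Q` is `5`-integral). [cite: SilvermanAEC2009, VII.3 Prop. 3.1] -/
theorem not_exists_two_nsmul_Q5302 :
    ¬ ∃ Z : (⟨-21, -22, -22, 0, 0⟩ : WeierstrassCurve ℚ).toAffine.Point, (Affine.Point.some _ _ nonsingular_5302_Q : (⟨-21, -22, -22, 0, 0⟩ : WeierstrassCurve ℚ).toAffine.Point) = (2 : ℕ) • Z := by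
  haveI : Fact (Nat.Prime 5) := ⟨Nat.prime_five⟩
  exact not_exists_two_nsmul_of_cert_5302 5 (by decide) (N := 10) (M := 5) rfl card_int5302_mod_five
    five_nsmul_Q5302 (by decide +kernel)

/-- **`P - Q ∉ 2E(ℚ)`** (certificate: `q = 13`, `N = 20`, `10(P - Q)` is `13`-integral; the class of `P - Q`
is `2`-divisible in `Ẽ(𝔽₅)` and `Ẽ(𝔽₇)`, so `13` is the first witness). [cite: SilvermanAEC2009, VII.3 Prop. 3.1] -/
theorem not_exists_two_nsmul_X5302 :
    ¬ ∃ Z : (⟨-21, -22, -22, 0, 0⟩ : WeierstrassCurve ℚ).toAffine.Point, (Affine.Point.some _ _ nonsingular_5302_X : (⟨-21, -22, -22, 0, 0⟩ : WeierstrassCurve ℚ).toAffine.Point) = (2 : ℕ) • Z := by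
  haveI : Fact (Nat.Prime 13) := ⟨by norm_num⟩
  exact not_exists_two_nsmul_of_cert_5302 13 (by decide) (N := 20) (M := 10) rfl card_int5302_mod_thirteen
    ten_nsmul_X5302 (by decide +kernel)

/-! ## §4 Independence of `P` and `Q` -/

/-- **`P` and `Q` are `ℤ`-independent in `E(ℚ)`**: `aP + bQ = O ⇒ a = b = 0`, by descent on `|a| + |b|`
through the parities of `a, b` (even–even: no `2`-torsion; otherwise `P`, `Q` or `P - Q` would be
`2`-divisible). [cite: SilvermanAEC2009, VII.3 Prop. 3.1] -/
theorem indep_5302 (a b : ℤ)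
    (hab : a • (Affine.Point.some _ _ nonsingular_5302_P : (⟨-21, -22, -22, 0, 0⟩ : WeierstrassCurve ℚ).toAffine.Point) + b • (Affine.Point.some _ _ nonsingular_5302_Q : (⟨-21, -22, -22, 0, 0⟩ : WeierstrassCurve ℚ).toAffine.Point) = 0) : a = 0 ∧ b = 0 := by
  -- strong induction on `|a| + |b|`
  suffices H : ∀ (n : ℕ) (a b : ℤ), a.natAbs + b.natAbs = n →
      a • (Affine.Point.some _ _ nonsingular_5302_P : (⟨-21, -22, -22, 0, 0⟩ : WeierstrassCurve ℚ).toAffine.Point) + b • (Affine.Point.some _ _ nonsingular_5302_Q : (⟨-21, -22, -22, 0, 0⟩ : WeierstrassCurve ℚ).toAffine.Point) = 0 → a = 0 ∧ b = 0 from H _ a b rfl hab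
  intro n
  induction n using Nat.strong_induction_on with
  | _ n ih =>
  intro a b hn hab
  rcases Int.even_or_odd a with ⟨a', ha⟩ | ⟨a', ha⟩ <;> rcases Int.even_or_odd b with ⟨b', hb⟩ | ⟨b', hb⟩
  · -- even / even: descend
    by_cases h0 : a = 0 ∧ b = 0
    · exact h0
    have h2 : (2 ^ 1 : ℕ) • (a' • (Affine.Point.some _ _ nonsingular_5302_P : (⟨-21, -22, -22, 0, 0⟩ : WeierstrassCurve ℚ).toAffine.Point) + b' • (Affine.Point.some _ _ nonsingular_5302_Q : (⟨-21, -22, -22, 0, 0⟩ : WeierstrassCurve ℚ).toAffine.Point)) = 0 := by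
      rw [← hab, ha, hb]
      module
    have hz := eq_zero_of_two_pow_nsmul_eq_zero_5302 _ 1 h2
    have haa : a.natAbs = 2 * a'.natAbs := by rw [ha, ← two_mul, Int.natAbs_mul]; rfl
    have hbb : b.natAbs = 2 * b'.natAbs := by rw [hb, ← two_mul, Int.natAbs_mul]; rfl
    have hne : a'.natAbs + b'.natAbs ≠ 0 := by
      intro hz0
      apply h0
      constructor
      · rw [ha]; have : a' = 0 := Int.natAbs_eq_zero.mp (by omega); rw [this]; rfl
      · rw [hb]; have : b' = 0 := Int.natAbs_eq_zero.mp (by omega); rw [this]; rfl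
    obtain ⟨ha0, hb0⟩ := ih (a'.natAbs + b'.natAbs) (by omega) a' b' rfl hz
    exact ⟨by rw [ha, ha0]; rfl, by rw [hb, hb0]; rfl⟩
  · -- `a` even, `b` odd: `Q ∈ 2E(ℚ)`
    refine absurd ⟨-(a' • (Affine.Point.some _ _ nonsingular_5302_P : (⟨-21, -22, -22, 0, 0⟩ : WeierstrassCurve ℚ).toAffine.Point)) - b' • (Affine.Point.some _ _ nonsingular_5302_Q : (⟨-21, -22, -22, 0, 0⟩ : WeierstrassCurve ℚ).toAffine.Point), ?_⟩ not_exists_two_nsmul_Q5302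
    have key : (Affine.Point.some _ _ nonsingular_5302_Q : (⟨-21, -22, -22, 0, 0⟩ : WeierstrassCurve ℚ).toAffine.Point) = (2 : ℕ) • (-(a' • (Affine.Point.some _ _ nonsingular_5302_P : (⟨-21, -22, -22, 0, 0⟩ : WeierstrassCurve ℚ).toAffine.Point)) - b' • (Affine.Point.some _ _ nonsingular_5302_Q : (⟨-21, -22, -22, 0, 0⟩ : WeierstrassCurve ℚ).toAffine.Point))
        + (a • (Affine.Point.some _ _ nonsingular_5302_P : (⟨-21, -22, -22, 0, 0⟩ : WeierstrassCurve ℚ).toAffine.Point) + b • (Affine.Point.some _ _ nonsingular_5302_Q : (⟨-21, -22, -22, 0, 0⟩ : WeierstrassCurve ℚ).toAffine.Point)) := by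
      rw [ha, hb]; module
    rw [hab, add_zero] at key
    exact key
  · -- `a` odd, `b` even: `P ∈ 2E(ℚ)`
    refine absurd ⟨-(a' • (Affine.Point.some _ _ nonsingular_5302_P : (⟨-21, -22, -22, 0, 0⟩ : WeierstrassCurve ℚ).toAffine.Point)) - b' • (Affine.Point.some _ _ nonsingular_5302_Q : (⟨-21, -22, -22, 0, 0⟩ : WeierstrassCurve ℚ).toAffine.Point), ?_⟩ not_exists_two_nsmul_P5302
    have key : (Affine.Point.some _ _ nonsingular_5302_P : (⟨-21, -22, -22, 0, 0⟩ : WeierstrassCurve ℚ).toAffine.Point) = (2 : ℕ) • (-(a' • (Affine.Point.some _ _ nonsingular_5302_P : (⟨-21, -22, -22, 0, 0⟩ : WeierstrassCurve ℚ).toAffine.Point)) - b' • (Affine.Point.some _ _ nonsingular_5302_Q : (⟨-21, -22, -22, 0, 0⟩ : WeierstrassCurve ℚ).toAffine.Point))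
        + (a • (Affine.Point.some _ _ nonsingular_5302_P : (⟨-21, -22, -22, 0, 0⟩ : WeierstrassCurve ℚ).toAffine.Point) + b • (Affine.Point.some _ _ nonsingular_5302_Q : (⟨-21, -22, -22, 0, 0⟩ : WeierstrassCurve ℚ).toAffine.Point)) := by
      rw [ha, hb]; module
    rw [hab, add_zero] at key
    exact key
  · -- both odd: `P - Q ∈ 2E(ℚ)`
    refine absurd ⟨-(a' • (Affine.Point.some _ _ nonsingular_5302_P : (⟨-21, -22, -22, 0, 0⟩ : WeierstrassCurve ℚ).toAffine.Point)) - (b' + 1) • (Affine.Point.some _ _ nonsingular_5302_Q : (⟨-21, -22, -22, 0, 0⟩ : WeierstrassCurve ℚ).toAffine.Point), ?_⟩ not_exists_two_nsmul_X5302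
    rw [← P_sub_Q_5302]
    have key : (Affine.Point.some _ _ nonsingular_5302_P : (⟨-21, -22, -22, 0, 0⟩ : WeierstrassCurve ℚ).toAffine.Point) - Affine.Point.some _ _ nonsingular_5302_Q
        = (2 : ℕ) • (-(a' • (Affine.Point.some _ _ nonsingular_5302_P : (⟨-21, -22, -22, 0, 0⟩ : WeierstrassCurve ℚ).toAffine.Point)) - (b' + 1) • (Affine.Point.some _ _ nonsingular_5302_Q : (⟨-21, -22, -22, 0, 0⟩ : WeierstrassCurve ℚ).toAffine.Point))
        + (a • (Affine.Point.some _ _ nonsingular_5302_P : (⟨-21, -22, -22, 0, 0⟩ : WeierstrassCurve ℚ).toAffine.Point) + b • (Affine.Point.some _ _ nonsingular_5302_Q : (⟨-21, -22, -22, 0, 0⟩ : WeierstrassCurve ℚ).toAffine.Point)) := by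
      rw [ha, hb]; module
    rw [hab, add_zero] at key
    exact key

/-- The same independence for an arbitrary `DecidableEq ℚ` instance behind the group law (a subsingleton;
`WeierstrassCurve.mordellWeilRank` uses the classical one). [folklore] -/
theorem indep_5302' [inst : DecidableEq ℚ] (a b : ℤ)
    (hab : a • (Affine.Point.some _ _ nonsingular_5302_P : (⟨-21, -22, -22, 0, 0⟩ : WeierstrassCurve ℚ).toAffine.Point) + b • (Affine.Point.some _ _ nonsingular_5302_Q : (⟨-21, -22, -22, 0, 0⟩ : WeierstrassCurve ℚ).toAffine.Point) = 0) : a = 0 ∧ b = 0 := by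
  have e : inst = instDecidableEqRat := Subsingleton.elim _ _
  subst e
  exact indep_5302 a b hab

/-- **`rank E(ℚ) ≥ 2`** for `E = [-21,-22,-22,0,0]` (`N = 5302`): `{P, Q}` is `ℤ`-linearly independent in the
finitely generated group `E(ℚ)` (Mordell–Weil, `module_finite_point_holds`).
[cite: SilvermanAEC2009, VII.3 Prop. 3.1 and Thm. VIII.6.7] -/
theorem two_le_mordellWeilRank_5302 :
    2 ≤ ((⟨-21, -22, -22, 0, 0⟩ : WeierstrassCurve ℤ).baseChange ℚ).mordellWeilRank := by
  have hbc : (⟨-21, -22, -22, 0, 0⟩ : WeierstrassCurve ℤ).baseChange ℚ = (⟨-21, -22, -22, 0, 0⟩ : WeierstrassCurve ℚ) := by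
    ext <;> simp [WeierstrassCurve.baseChange, WeierstrassCurve.map]
  rw [hbc]
  haveI : (⟨-21, -22, -22, 0, 0⟩ : WeierstrassCurve ℚ).IsElliptic := by
    rw [← hbc]; exact isElliptic_baseChange_int _ (by
      norm_num [WeierstrassCurve.Δ, WeierstrassCurve.b₂, WeierstrassCurve.b₄, WeierstrassCurve.b₆,
        WeierstrassCurve.b₈])
  letI := Classical.decEq ℚ
  haveI : Module.Finite ℤ (⟨-21, -22, -22, 0, 0⟩ : WeierstrassCurve ℚ).toAffine.Point := WeierstrassCurve.module_finite_point_holds _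
  have hli : LinearIndependent ℤ ![(Affine.Point.some _ _ nonsingular_5302_P : (⟨-21, -22, -22, 0, 0⟩ : WeierstrassCurve ℚ).toAffine.Point), Affine.Point.some _ _ nonsingular_5302_Q] := by
    refine Fintype.linearIndependent_iff.mpr fun g hg i ↦ ?_
    simp only [Fin.sum_univ_two, Matrix.cons_val_zero, Matrix.cons_val_one,
      Matrix.cons_val_fin_one] at hg
    obtain ⟨h0, h1⟩ := indep_5302' (g 0) (g 1) hg
    fin_cases i
    · exact h0
    · exact h1
  have := hli.fintype_card_le_finrank
  rw [Fintype.card_fin] at this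
  unfold WeierstrassCurve.mordellWeilRank
  exact this

/-- **`corank Sel_{5^∞}(E/ℚ) ≥ 2`** for the sector member `E` (Greenberg's identity
`corank Sel_{p^∞} = rank + corank Ш[p^∞]`). [cite: Greenberg1999LNM, §1 pp. 54–57] -/
theorem two_le_selmerCorank_5302 :
    2 ≤ ((⟨-21, -22, -22, 0, 0⟩ : WeierstrassCurve ℤ).baseChange ℚ).selmerCorank 5 := by
  obtain ⟨hE, -, -⟩ := shaCotorsionReducible_sector_5302
  haveI := hE
  have hId := ((⟨-21, -22, -22, 0, 0⟩ : WeierstrassCurve ℤ).baseChange ℚ).selmerCorank_eq_mordellWeilRank_add_holds 5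
  have h2 := two_le_mordellWeilRank_5302
  omega

/-! ## §5 Consequences for the crux -/

/-- **The strengthening "every Eisenstein-sector member has rank `≤ 1`" of `ShaCotorsionReducible` is FALSE**
(so the crux does not reduce to the landed `r_an ≤ 1` / rank-`≤ 1` regime lemmas): witness
`([-21,-22,-22,0,0], 5)`. [cite: SilvermanAEC2009, VII.3 Prop. 3.1] -/
theorem shaCotorsionReducible_strengthening_rank_le_one_false :
    ¬ ∀ (W : WeierstrassCurve ℚ) [W.IsElliptic] [W.IsGloballyMinimal] (p : ℕ) [Fact p.Prime],
        5 ≤ p → W.HasGoodReductionAtPrime p → ¬ (p : ℤ) ∣ W.frobeniusTrace p →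
        ¬ W.HasIrreducibleModPGaloisRep p → W.mordellWeilRank ≤ 1 := by
  intro h
  obtain ⟨hE, hmin, hgood, -, hord, hred⟩ := shaCotorsionReducible_sector_5302
  have h1 := h _ 5 le_rfl hgood hord hred
  have h2 := two_le_mordellWeilRank_5302
  omega

/-- **The open residue of the crux is inhabited, granting Gross–Zagier–Kolyvagin.** Under the tree fact
`rank_eq_analyticRank_of_analyticRank_le_one` (`r_an ≤ 1 ⇒ rank = r_an`; Darmon 2004, Thm. 3.22), the sector
member `([-21,-22,-22,0,0], 5)` has `r_an ≥ 2` and `corank Sel_{5^∞} ≥ 2` — it lies in the residue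
`2 ≤ r_an ∧ 1 ≤ corank Sel` of `Theorems.shaCotorsionReducible_iff_residue` (p150969), where no engine in print
decides `corank Sel ≤ rank`. [cite: Darmon2004, Thm. 3.22] [cite: Greenberg1999LNM, §1 pp. 54–57] -/
theorem shaCotorsionReducible_residue_inhabited_of_GZK
    (hGZK : rank_eq_analyticRank_of_analyticRank_le_one) :
    ∃ (W : WeierstrassCurve ℚ) (_ : W.IsElliptic) (_ : W.IsGloballyMinimal) (_ : Fact (Nat.Prime 5)),
      W.HasGoodReductionAtPrime 5 ∧ ¬ (5 : ℤ) ∣ W.frobeniusTrace 5 ∧ ¬ W.HasIrreducibleModPGaloisRep 5 ∧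
      2 ≤ W.analyticRank ∧ 2 ≤ W.selmerCorank 5 ∧ 2 ≤ W.mordellWeilRank := by
  obtain ⟨hE, hmin, hgood, -, hord, hred⟩ := shaCotorsionReducible_sector_5302
  haveI := hE
  refine ⟨_, hE, hmin, inferInstance, hgood, hord, hred, ?_, two_le_selmerCorank_5302,
    two_le_mordellWeilRank_5302⟩
  by_contra hlt
  have h1 : ((⟨-21, -22, -22, 0, 0⟩ : WeierstrassCurve ℤ).baseChange ℚ).analyticRank ≤ 1 := by omega
  have h2 := (hGZK _ h1).1
  have h3 := two_le_mordellWeilRank_5302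
  omega

end Summit.BirchSwinnertonDyer.BirchSwinnertonDyer.Theorems.ShaCotorsionReducible.Negative

end
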